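import Literature.MathematicalPhysics.QuantumFieldTheory.Balaban1983to89.B12Lemma4ConcreteFrame
import Literature.MathematicalPhysics.QuantumFieldTheory.Balaban1983to89.B12CauchyRemainder354

/-!
# `Balaban1983to89.B12Lemma4Uses` — T. Bałaban, *Renormalization group approach to lattice gauge field theories. I*,
Commun. Math. Phys. **109** (1987) 249–301 [Balaban1987RG1], pp. 275–280: **THE USES OF LEMMA 4 ON THE CONCRETE FRAME** —
the three printed sentences that CONSUME Lemma 4 (3.53), proved on the concrete frame `B12Lemma4ConcreteFrame.frameOf D` over
`B12RegularSpaces111` from `lemma4Printed_frameOf` and the p. 263 hypotheses on `𝐄^{(j)}(X, ·)` ((1.18) analyticity and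
sup bound, (1.19) gauge invariance) in their printed shapes:

* p. 277 [PDF 29] «The analyticity of the functions in (3.34) follows from the analyticity of the two functions in (3.36), and the
  assumed analyticity of 𝐄^{(j)}(X, 𝐔, 𝐉) on the space U^c_j(X, α₀, α₁).» — `analyticAt_E_comp` (composition);
* p. 280 [PDF 32], (3.54): the function `σ ↦ 𝐄^{(j)}(X, U_j(□₀, exp i(τB + σB)))` is holomorphic and bounded by the (1.18) sup for
  `|σB| < α₃` «(the paper: Lemma 4 with B′ = σB, |σ| < r = α₃/|B|, and (1.18))» — i.e. THE TWO HYPOTHESES `hΦ`, `hM` OF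
  `B12CauchyRemainder354.ineq354` (unit r20, row `B12.Eq3.54`, stated there for an abstract `Φ`) DISCHARGED from Lemma 4 on the frame:
  `differentiableOn_E_slice`, `norm_E_slice_le`, the Cauchy estimate in the `B′`-direction `norm_iteratedDeriv_E_slice_le` /
  `ineq354_direction` (`= 5!` × the printed right member `E₀α₃⁻⁵|B|⁵exp(−κd_j(X))`), and (3.54) END TO END `ineq354_frameOf` /
  `ineq354_frameOf_printed` (r20's `ineq354` fed with the frame's slices; the one-variable function `z ↦ 𝐄^{(j)}(X, U_j(□₀, exp izB))`
  enters through the coherence «the configuration of (3.53) depends on τB + B′ only», hypothesis `hcoh`);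
* p. 275 [PDF 27] «This is obviously a well defined and analytic function of the variables 𝐔, 𝐉 in a sufficiently small domain. We
  will prove that it [(3.25)] is analytic on the space U^c_{k+1}(□₀, (1+2β)α₀, (1+2β)α₁, α₀).» — `analyticAt_E325_of_eq328`: modulo the
  configuration-level identity behind (3.28) p. 276 («Performing these gauge transformations in (3.25) we obtain (3.28)»: the (3.25)
  configuration is a `Gᶜ`-valued gauge transform of the Lemma-4 configuration — BY REFERENCE, hypothesis `h328`) and (1.19).

HONEST FRAMING (cell `lit-balaban`, verbatim): statement-level skeleton of published theorems with citation tags; proofs where landed; nothing here is a claim about the Yang–Mills mass gap.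

PDF held: `paper:balaban1987-cmp109-rg-i-small-field` (journal page = PDF page + 248); pp. 263, 275–280 [PDF 15, 27–32] re-read for
this module on the renders `run/shared/lean/pub/pub-balaban/b2b-balaban-ref1/pages/1987-cmp109-rg-I-small-field/…-p015/p027/p028/p031/p032-x2.png`.

THE PRINT (p. 263 verbatim; (3.54) as read per TRANSCRIPT NOTE (T1) of `B12CauchyRemainder354` — the render p032-x2 prints `sup_{r∈[0,1]}`
with `|σ| = r` under the contour; the sup variable is τ, the contour radius r = α₃|B|⁻¹; ref-1 gen 41 F4-nit on p303919, docstring-only v1.2).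
p. 263 [15]: *«We assume that the function 𝐄^{(j)}(X, g_{j−1}, 𝐔, 𝐉) is defined and analytic on the space
U^c_j(X, α₀, α₁) … There exists a constant E₀ such that |𝐄^{(j)}(X, g_{j−1}, 𝐔, 𝐉)| ≦ E₀ exp(−κd_j(X)) (1.18) … for all configurations
(𝐔, 𝐉) ∈ U^c_j(X, α₀, α₁). … 𝐄^{(j)}(X, g_{j−1}, 𝐔^u, R(u)𝐉) = 𝐄^{(j)}(X, g_{j−1}, 𝐔, 𝐉) (1.19) for all Gᶜ-valued gauge transformations
u.»*  p. 280 [32]: *«Lemma 4. … (U_j(□₀, exp i(τB + B′)), J_j(□₀, exp i(τB + B′)))|_X ∈ U^c_j(X, α₀, α₁) (3.53) … The functions in (3.53)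
are analytic on the above spaces. Let us consider the last term in (3.34). We want to bound it by an expression of the form (3.35). We have
|∫₀¹ dτ ((1−τ)⁴/4!) ⟨(δ⁵/δB⁵)𝐄^{(j)}(X, U_j(□₀, exp iτB)), ⊗⁵B⟩| ≦ sup_{τ∈[0,1]} |∫_{|σ|=r} dσ σ⁻⁶ 𝐄^{(j)}(X, U_j(□₀, exp i(τB + σB)))|
≦ E₀α₃⁻⁵|B|⁵exp(−κd_j(X)). (3.54)»*

THE READING (located; as in `B12Eq44Analytic` READING (b) and `B12Lemma4ConcreteFrame`).  `𝐄^{(j)}(X, ·)` is a function `E` on the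
ambient complex-linear carrier `(bonds → 𝔸) × (bonds → 𝔸)` of the pairs (the units `𝐔` through their values in `𝔸`), with values in a
complex Banach space `V` (print: `ℂ`); «analytic on U^c_j(X, α₀, α₁)» = `AnalyticAt ℂ E` at the pair of every point of the concrete space
`space′ 𝓜 F cs α₀ α₁` (hypothesis `hE`); (1.18) = a uniform bound `M` there (`hM`, print `M = E₀exp(−κd_j(X))`); (1.19) = invariance of
`E` under the action (1.10) of `Gᶜ`-valued gauge transformations on the space (`hinv`).  The Lemma-4 configuration is the frame's
`comp 𝐔 𝐀 τ B′ = (V, J(V))`, `V = exp iξ(𝐊(𝐔, 𝐀, τ) + 𝐀₂(𝐔, 𝐀, τ, B′))` (`B12Lemma4ConcreteFrame.frameOf_comp`); «analytic … on the above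
spaces» = along analytic families of the letters (`LettersAnalyticAt`), here in particular along the complex lines `σ ↦ B′₀ + σW` of the
`B′`-slot with `𝐔, 𝐀` fixed (`lettersAnalyticAt_slice`) — the slices of (3.54) are `B′₀ = 0`, `W = B`.  `|B′|` is the frame's abstract size
`normB`; what (3.54) uses of it is recorded as hypotheses in printed shape: the domain `|σB| < α₃` for `|σ| < r` (`hdom`), resp.
`|σW| ≤ |σ|·|W|` (`hhom`, absolute homogeneity of the sup norm) with `r = α₃/|W|`.

WHAT IS PROVED (theorems only; 0 sorry, 0 new definitions, 0 new `Prop`-facts; axioms standard): §1 `analyticAt_E_comp`; §2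
`lettersAnalyticAt_slice`, `analyticAt_E_slice`, `differentiableOn_E_slice`, `norm_E_slice_le`, `slice_dom_of_hom`; §3
`norm_iteratedDeriv_E_slice_le`, `ineq354_direction`; §4 `differentiableOn_E354_ball`, `norm_E354_le`, `ineq354_frameOf`,
`ineq354_frameOf_printed`; §5 `E_act_comp_eq`, `analyticAt_E325_of_eq328`; v1.1: §6 `E_ofBackground_gaugeU_comp_eq`, `eq42_of_eq337` ((4.2)
p. 281 on the frame), `analyticAt_E325_of_eq328U` (the `𝐔`-level reading of (3.28)); §7 `lemma4PrintedSmall_frameOf` (`B12Sec2to5.Lemma4PrintedSmall`).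
HONEST SCOPE.  What is by reference stays by reference: the frame `D : Lemma4Data` packages the [15]-inputs of Lemma 4 (see
`B12Lemma4ConcreteFrame`); this module adds no input of its own except, in printed shape, the p. 263 hypotheses on `𝐄^{(j)}` and, in §4/§5,
the two identities the print uses tacitly — «U_j(□₀, exp i(τB + σB)) is a function of (τ + σ)B» (`hcoh`) and «(3.25) = a gauge transform
of the Lemma-4 configuration» ((3.26)–(3.28), (3.30)/(3.48): `h328`).  The localisation caveat after (3.54) («this bound holds on □̃⁴
only …») and the constant remark are not formalized (rows `B12.Txt@281`, `B12.Eq4.1`).  Unit `lit-balaban-p07` (Phase-2 seat p07 gen 9;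
free-target protocol G.5-34(d); TAKING line HOME/STATUS.md 2026-08-21T20:26:35Z; rows B12.Lem4 / B12.Eq3.54 / B12.Eq3.24-3.25, owners
r09/r20, referee ref-5), HOME `run/shared/lean/pub/lit-balaban/`.
-/

noncomputable section

open NormedSpace Complex Set Metric Filter
open scoped Topology Nat

namespace Literature.MathematicalPhysics.QuantumFieldTheory.Balaban1983to89.B12Lemma4Uses

open Literature.MathematicalPhysics.QuantumFieldTheory.Balaban1983to89
open Literature.MathematicalPhysics.QuantumFieldTheory.Balaban1983to89.B12RegularSpaces111
open Literature.MathematicalPhysics.QuantumFieldTheory.Balaban1983to89.B12Eq18Current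
open Literature.MathematicalPhysics.QuantumFieldTheory.Balaban1983to89.B12Lemma4ConcreteFrame
open Literature.MathematicalPhysics.QuantumFieldTheory.Balaban1983to89.B12CondIIIJConcreteModels (analyticAt_pair_lemma4)
open Literature.MathematicalPhysics.QuantumFieldTheory.Balaban1983to89.B12CauchyRemainder354
  (norm_iteratedDeriv_le_of_ball ineq354 ineq354_printed)

variable {P : Params} {i : ℕ} {𝔸 : Type} [NormedRing 𝔸] [NormedAlgebra ℂ 𝔸] [CompleteSpace 𝔸]
variable {𝓜 : Model 𝔸} {c : B12Sec2to5.Lemma4Consts}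
variable {V : Type*} [NormedAddCommGroup V] [NormedSpace ℂ V]

/-! ## §1. p. 277: «The analyticity of the functions in (3.34) follows from the analyticity of the two functions in (3.36), and the
assumed analyticity of 𝐄^{(j)}(X, 𝐔, 𝐉) on the space U^c_j(X, α₀, α₁)» — composition -/

/-- **p. 277, the analyticity sentence, on the concrete frame** (also the p. 275 claim for the function after (3.28)/(3.30)): for
every package `D` of the by-reference inputs of Lemma 4, under «all the restrictions», if `𝐄^{(j)}(X, ·)` is analytic at (the pair of)
every point of `U^c_j(X, α₀, α₁)` (p. 263), then along every analytic family of the variables `e ↦ (𝐔(e), 𝐉(e)), 𝐀(e), B′(e)` through a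
point of the printed domain (`𝐔 ∈ U′ᶜ_{k+1}(□₀, (1+2β)α₀, (1+2β)α₁)`, `𝐀` in (3.31), `|B′| < α₃`) and for every `τ ∈ [0, 1]`, the function
`e ↦ 𝐄^{(j)}(X, U_j(□₀, exp i(τB + B′)), J_j(□₀, exp i(τB + B′)))` — `E` at the frame's pair `(V, J(V))`, `V = exp iξ(𝐊 + 𝐀₂)` — is analytic
at that point: Lemma 4 (membership `comp_mem_Ucj` + analyticity of the pair `analyticAt_pair_lemma4`) composed with the hypothesis.
[cite: Balaban1987RG1, p.277 after (3.36); Lemma 4 (3.53) p.280; p.263 (1.18)] -/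
theorem analyticAt_E_comp [NormOneClass 𝔸] (D : Lemma4Data P i 𝓜 c) (hR : B12Sec2to5.Lemma4Restrictions c)
    (E : (PBond P i → 𝔸) × (PBond P i → 𝔸) → V)
    (hE : ∀ Ψ ∈ space' 𝓜 D.F D.cs c.α₀ c.α₁, AnalyticAt ℂ E ((fun b => (Ψ.U b : 𝔸)), Ψ.J))
    {W : Type} [NormedAddCommGroup W] [NormedSpace ℂ W] {Φf : W → FieldPair P i 𝔸ˣ 𝔸} {Af Bf : W → PBond P i → 𝔸}
    {e₀ : W} {τ : ℝ} (hLe : LettersAnalyticAt Φf Af Bf e₀)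
    (hΦ : Φf e₀ ∈ space 𝓜 D.F' D.cs' ((1 + 2 * c.β) * c.α₀) ((1 + 2 * c.β) * c.α₁) D.γ₀') (hA : Af e₀ ∈ D.A331)
    (hτ0 : 0 ≤ τ) (hτ1 : τ ≤ 1) (hB' : D.normB (Bf e₀) < c.α₃) :
    AnalyticAt ℂ (fun e : W => E
      ((fun b => ((ofBackground D.π D.cs.ξ
          (fun b => expI D.cs.ξ (D.K (Φf e) (Af e) τ b + D.A₂ (Φf e) (Af e) τ (Bf e) b))).U b : 𝔸)),
        (ofBackground D.π D.cs.ξ (fun b => expI D.cs.ξ (D.K (Φf e) (Af e) τ b + D.A₂ (Φf e) (Af e) τ (Bf e) b))).J)) e₀ := by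
  have hpair := analyticAt_pair_lemma4 (P := P) (i := i) D.hπn D.cs.ξ (D.hKan τ hLe hΦ hA hτ0 hτ1 hB')
    (D.hA2an τ hLe hΦ hA hτ0 hτ1 hB')
  have hmem := comp_mem_Ucj D hR hΦ hA hτ0 hτ1 hB'
  exact (hE _ hmem).comp_of_eq hpair rfl

/-! ## §2. p. 280 (3.54): the `B′`-slices of the Lemma-4 configuration — holomorphic and bounded (the hypotheses of r20's `ineq354`) -/

omit [NormedAlgebra ℂ 𝔸] [CompleteSpace 𝔸] in
/-- The family of the variables used by (3.54): `𝐔, 𝐀` fixed and `B′` moving on the complex line `σ ↦ B′₀ + σW` (print: `B′₀ = 0`,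
`W = B`, `B′ = σB`) is an analytic family of letters. [cite: Balaban1987RG1, (3.54) p.280] -/
theorem lettersAnalyticAt_slice [NormedAlgebra ℂ 𝔸] (Φ : FieldPair P i 𝔸ˣ 𝔸) (A B₀ W : PBond P i → 𝔸) (σ₀ : ℂ) :
    LettersAnalyticAt (fun _ : ℂ => Φ) (fun _ => A) (fun σ : ℂ => B₀ + σ • W) σ₀ := by
  refine ⟨fun b => analyticAt_const, fun b => analyticAt_const, fun b => analyticAt_const, fun b => ?_⟩
  simp only [Pi.add_apply, Pi.smul_apply]
  exact analyticAt_const.add (analyticAt_id.smul analyticAt_const)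

/-- **The slices of (3.54) are holomorphic, pointwise**: for `𝐔` in the upper space, `𝐀` in (3.31), `τ ∈ [0, 1]` and a point `σ₀` of the
line with `|B′₀ + σ₀W| < α₃`, the function `σ ↦ 𝐄^{(j)}(X, (V, J(V))(𝐔, 𝐀, τ, B′₀ + σW))` is analytic at `σ₀` (§1 along the family of
`lettersAnalyticAt_slice`). [cite: Balaban1987RG1, (3.54) p.280; Lemma 4 p.280] -/
theorem analyticAt_E_slice [NormOneClass 𝔸] (D : Lemma4Data P i 𝓜 c) (hR : B12Sec2to5.Lemma4Restrictions c)
    (E : (PBond P i → 𝔸) × (PBond P i → 𝔸) → V)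
    (hE : ∀ Ψ ∈ space' 𝓜 D.F D.cs c.α₀ c.α₁, AnalyticAt ℂ E ((fun b => (Ψ.U b : 𝔸)), Ψ.J))
    {Φ : FieldPair P i 𝔸ˣ 𝔸} {A B₀ W : PBond P i → 𝔸} {τ : ℝ}
    (hΦ : Φ ∈ space 𝓜 D.F' D.cs' ((1 + 2 * c.β) * c.α₀) ((1 + 2 * c.β) * c.α₁) D.γ₀') (hA : A ∈ D.A331)
    (hτ0 : 0 ≤ τ) (hτ1 : τ ≤ 1) {σ₀ : ℂ} (hσ₀ : D.normB (B₀ + σ₀ • W) < c.α₃) :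
    AnalyticAt ℂ (fun σ : ℂ => E
      ((fun b => ((ofBackground D.π D.cs.ξ
          (fun b => expI D.cs.ξ (D.K Φ A τ b + D.A₂ Φ A τ (B₀ + σ • W) b))).U b : 𝔸)),
        (ofBackground D.π D.cs.ξ (fun b => expI D.cs.ξ (D.K Φ A τ b + D.A₂ Φ A τ (B₀ + σ • W) b))).J)) σ₀ :=
  analyticAt_E_comp D hR E hE (lettersAnalyticAt_slice Φ A B₀ W σ₀) hΦ hA hτ0 hτ1 hσ₀

/-- **Hypothesis `hΦ` of `B12CauchyRemainder354.ineq354`, discharged**: on a disc `|σ| < r` along which `|B′₀ + σW| < α₃`, the slice is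
holomorphic. [cite: Balaban1987RG1, (3.54) p.280; Lemma 4 p.280] -/
theorem differentiableOn_E_slice [NormOneClass 𝔸] (D : Lemma4Data P i 𝓜 c) (hR : B12Sec2to5.Lemma4Restrictions c)
    (E : (PBond P i → 𝔸) × (PBond P i → 𝔸) → V)
    (hE : ∀ Ψ ∈ space' 𝓜 D.F D.cs c.α₀ c.α₁, AnalyticAt ℂ E ((fun b => (Ψ.U b : 𝔸)), Ψ.J))
    {Φ : FieldPair P i 𝔸ˣ 𝔸} {A B₀ W : PBond P i → 𝔸} {τ : ℝ}
    (hΦ : Φ ∈ space 𝓜 D.F' D.cs' ((1 + 2 * c.β) * c.α₀) ((1 + 2 * c.β) * c.α₁) D.γ₀') (hA : A ∈ D.A331)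
    (hτ0 : 0 ≤ τ) (hτ1 : τ ≤ 1) {σc : ℂ} {r : ℝ} (hdom : ∀ σ ∈ ball σc r, D.normB (B₀ + σ • W) < c.α₃) :
    DifferentiableOn ℂ (fun σ : ℂ => E
      ((fun b => ((ofBackground D.π D.cs.ξ
          (fun b => expI D.cs.ξ (D.K Φ A τ b + D.A₂ Φ A τ (B₀ + σ • W) b))).U b : 𝔸)),
        (ofBackground D.π D.cs.ξ (fun b => expI D.cs.ξ (D.K Φ A τ b + D.A₂ Φ A τ (B₀ + σ • W) b))).J)) (ball σc r) :=
  fun σ hσ => (analyticAt_E_slice D hR E hE hΦ hA hτ0 hτ1 (hdom σ hσ)).differentiableAt.differentiableWithinAt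

omit [NormedSpace ℂ V] in
/-- **Hypothesis `hM` of `B12CauchyRemainder354.ineq354`, discharged**: on the same disc the slice is bounded by the (1.18) sup `M` of
`𝐄^{(j)}(X, ·)` on `U^c_j(X, α₀, α₁)` (print: `M = E₀exp(−κd_j(X))`), because the configuration lies in the space (Lemma 4).
[cite: Balaban1987RG1, (3.54) p.280; (1.18) p.263] -/
theorem norm_E_slice_le [NormOneClass 𝔸] (D : Lemma4Data P i 𝓜 c) (hR : B12Sec2to5.Lemma4Restrictions c)
    (E : (PBond P i → 𝔸) × (PBond P i → 𝔸) → V) {M : ℝ}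
    (hM : ∀ Ψ ∈ space' 𝓜 D.F D.cs c.α₀ c.α₁, ‖E ((fun b => (Ψ.U b : 𝔸)), Ψ.J)‖ ≤ M)
    {Φ : FieldPair P i 𝔸ˣ 𝔸} {A B₀ W : PBond P i → 𝔸} {τ : ℝ}
    (hΦ : Φ ∈ space 𝓜 D.F' D.cs' ((1 + 2 * c.β) * c.α₀) ((1 + 2 * c.β) * c.α₁) D.γ₀') (hA : A ∈ D.A331)
    (hτ0 : 0 ≤ τ) (hτ1 : τ ≤ 1) {σc : ℂ} {r : ℝ} (hdom : ∀ σ ∈ ball σc r, D.normB (B₀ + σ • W) < c.α₃) :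
    ∀ σ ∈ ball σc r, ‖E
      ((fun b => ((ofBackground D.π D.cs.ξ
          (fun b => expI D.cs.ξ (D.K Φ A τ b + D.A₂ Φ A τ (B₀ + σ • W) b))).U b : 𝔸)),
        (ofBackground D.π D.cs.ξ (fun b => expI D.cs.ξ (D.K Φ A τ b + D.A₂ Φ A τ (B₀ + σ • W) b))).J)‖ ≤ M :=
  fun σ hσ => hM _ (comp_mem_Ucj D hR hΦ hA hτ0 hτ1 (hdom σ hσ))

omit [NormedRing 𝔸] [NormedAlgebra ℂ 𝔸] [CompleteSpace 𝔸] in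
/-- The printed domain of the slices: if `|·|` is subadditive and absolutely homogeneous along the line in the shape
`|B′₀ + σW| ≤ |B′₀| + |σ|·nW` (`nW` standing for `|W| ≥ 0`), `|B′₀| < α₃` and `|B′₀| + r·nW ≤ α₃`, then `|B′₀ + σW| < α₃` on `|σ| < r`
(print: `B′₀ = 0`, `r = α₃/|B|`, «so that B′ = σB has |B′| < α₃»). [cite: Balaban1987RG1, (3.54) p.280] -/
theorem slice_dom_of_hom [NormedRing 𝔸] [NormedAlgebra ℂ 𝔸] {normB : (PBond P i → 𝔸) → ℝ} {B₀ W : PBond P i → 𝔸}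
    {nW r a : ℝ} (hsub : ∀ σ : ℂ, normB (B₀ + σ • W) ≤ normB B₀ + ‖σ‖ * nW) (hnW : 0 ≤ nW) (hB₀ : normB B₀ < a)
    (hr : normB B₀ + r * nW ≤ a) : ∀ σ ∈ ball (0 : ℂ) r, normB (B₀ + σ • W) < a := by
  intro σ hσ
  rw [mem_ball_zero_iff] at hσ
  rcases hnW.eq_or_lt with h0 | hpos
  · have := hsub σ
    rw [← h0, mul_zero, add_zero] at this
    exact this.trans_lt hB₀
  · calc normB (B₀ + σ • W) ≤ normB B₀ + ‖σ‖ * nW := hsub σ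
      _ < normB B₀ + r * nW := by gcongr
      _ ≤ a := hr

/-! ## §3. p. 280 (3.54): the Cauchy estimate in the `B′`-direction -/

/-- **(3.54), the Cauchy estimate, in the `B′`-direction on the concrete frame**: if the slice domain `|B′₀ + σW| < α₃` contains the disc
`|σ| < r` (`r > 0`) and `𝐄^{(j)}(X, ·)` is analytic on `U^c_j(X, α₀, α₁)` and bounded there by `M`, then
`‖(d/dσ)ⁿ|_{σ=0} 𝐄^{(j)}(X, (V, J(V))(𝐔, 𝐀, τ, B′₀ + σW))‖ ≤ n!·M/rⁿ` — r20's `norm_iteratedDeriv_le_of_ball` with both hypotheses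
discharged by §2. [cite: Balaban1987RG1, (3.54) p.280] -/
theorem norm_iteratedDeriv_E_slice_le [NormOneClass 𝔸] [CompleteSpace V] (D : Lemma4Data P i 𝓜 c)
    (hR : B12Sec2to5.Lemma4Restrictions c) (E : (PBond P i → 𝔸) × (PBond P i → 𝔸) → V) {M : ℝ}
    (hE : ∀ Ψ ∈ space' 𝓜 D.F D.cs c.α₀ c.α₁, AnalyticAt ℂ E ((fun b => (Ψ.U b : 𝔸)), Ψ.J))
    (hM : ∀ Ψ ∈ space' 𝓜 D.F D.cs c.α₀ c.α₁, ‖E ((fun b => (Ψ.U b : 𝔸)), Ψ.J)‖ ≤ M)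
    {Φ : FieldPair P i 𝔸ˣ 𝔸} {A B₀ W : PBond P i → 𝔸} {τ : ℝ}
    (hΦ : Φ ∈ space 𝓜 D.F' D.cs' ((1 + 2 * c.β) * c.α₀) ((1 + 2 * c.β) * c.α₁) D.γ₀') (hA : A ∈ D.A331)
    (hτ0 : 0 ≤ τ) (hτ1 : τ ≤ 1) {r : ℝ} (hr : 0 < r) (hdom : ∀ σ ∈ ball (0 : ℂ) r, D.normB (B₀ + σ • W) < c.α₃) (n : ℕ) :
    ‖iteratedDeriv n (fun σ : ℂ => E
      ((fun b => ((ofBackground D.π D.cs.ξ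
          (fun b => expI D.cs.ξ (D.K Φ A τ b + D.A₂ Φ A τ (B₀ + σ • W) b))).U b : 𝔸)),
        (ofBackground D.π D.cs.ξ (fun b => expI D.cs.ξ (D.K Φ A τ b + D.A₂ Φ A τ (B₀ + σ • W) b))).J)) 0‖
      ≤ n ! * M / r ^ n :=
  norm_iteratedDeriv_le_of_ball hr (differentiableOn_E_slice D hR E hE hΦ hA hτ0 hτ1 hdom)
    (norm_E_slice_le D hR E hM hΦ hA hτ0 hτ1 hdom) n

/-- **(3.54) with the printed constants, in the direction `B`** (`B′₀ = 0`, `r = α₃/|B|`, `M = E₀exp(−κd_j(X))`): for `|B| = nB > 0` with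
`|σB| ≤ |σ|·|B|`, the fifth `σ`-derivative at `σ = 0` of `σ ↦ 𝐄^{(j)}(X, (V, J(V))(𝐔, 𝐀, τ, σB))` has norm
`≤ 5!·E₀α₃⁻⁵|B|⁵exp(−κd_j(X))` — `5!` times the printed right member of (3.54) (the `5!` is the one absorbed by `∫₀¹(1−τ)⁴/4! dτ = 1/5!` in
its left member, `B12CauchyRemainder354.ineq354`). [cite: Balaban1987RG1, (3.54) p.280] -/
theorem ineq354_direction [NormOneClass 𝔸] [CompleteSpace V] (D : Lemma4Data P i 𝓜 c)
    (hR : B12Sec2to5.Lemma4Restrictions c) (E : (PBond P i → 𝔸) × (PBond P i → 𝔸) → V) {E₀ κ d : ℝ}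
    (hE : ∀ Ψ ∈ space' 𝓜 D.F D.cs c.α₀ c.α₁, AnalyticAt ℂ E ((fun b => (Ψ.U b : 𝔸)), Ψ.J))
    (hM : ∀ Ψ ∈ space' 𝓜 D.F D.cs c.α₀ c.α₁, ‖E ((fun b => (Ψ.U b : 𝔸)), Ψ.J)‖ ≤ E₀ * Real.exp (-(κ * d)))
    {Φ : FieldPair P i 𝔸ˣ 𝔸} {A B : PBond P i → 𝔸} {τ : ℝ}
    (hΦ : Φ ∈ space 𝓜 D.F' D.cs' ((1 + 2 * c.β) * c.α₀) ((1 + 2 * c.β) * c.α₁) D.γ₀') (hA : A ∈ D.A331)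
    (hτ0 : 0 ≤ τ) (hτ1 : τ ≤ 1) {nB : ℝ} (hnB : 0 < nB) (hhom : ∀ σ : ℂ, D.normB (σ • B) ≤ ‖σ‖ * nB) :
    ‖iteratedDeriv 5 (fun σ : ℂ => E
      ((fun b => ((ofBackground D.π D.cs.ξ
          (fun b => expI D.cs.ξ (D.K Φ A τ b + D.A₂ Φ A τ (σ • B) b))).U b : 𝔸)),
        (ofBackground D.π D.cs.ξ (fun b => expI D.cs.ξ (D.K Φ A τ b + D.A₂ Φ A τ (σ • B) b))).J)) 0‖
      ≤ 5 ! * (E₀ * c.α₃⁻¹ ^ 5 * nB ^ 5 * Real.exp (-(κ * d))) := by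
  have hα₃ : 0 < c.α₃ := hR.2.2.2.1
  have hr : 0 < c.α₃ / nB := div_pos hα₃ hnB
  -- the printed domain: |σB| ≤ |σ|·|B| < (α₃/|B|)·|B| = α₃
  have hdom : ∀ σ ∈ ball (0 : ℂ) (c.α₃ / nB), D.normB ((0 : PBond P i → 𝔸) + σ • B) < c.α₃ := by
    intro σ hσ
    rw [mem_ball_zero_iff] at hσ
    rw [zero_add]
    calc D.normB (σ • B) ≤ ‖σ‖ * nB := hhom σ
      _ < c.α₃ / nB * nB := by gcongr
      _ = c.α₃ := div_mul_cancel₀ _ hnB.ne'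
  have h := norm_iteratedDeriv_E_slice_le D hR E hE hM hΦ hA hτ0 hτ1 hr hdom 5
  simp only [zero_add] at h
  refine h.trans (le_of_eq ?_)
  field_simp

/-! ## §4. p. 280 (3.54) end to end on the concrete frame: r20's `ineq354` with its hypotheses discharged -/

/-- The one-variable function of (3.54), `z ↦ 𝐄^{(j)}(X, U_j(□₀, exp izB))` (here `E` at the pair of `G z`, `G` the configuration as a
function of the complex Taylor parameter `z = τ + σ`), agrees on the disc `|z − τ| < r` with the `τ`-slice of the Lemma-4 configuration in
the direction `B` — this is the coherence «U_j(□₀, exp i(τB + σB)) is a function of (τ + σ)B» (`hcoh`) — hence is holomorphic there.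
[cite: Balaban1987RG1, (3.54) p.280] -/
theorem differentiableOn_E354_ball [NormOneClass 𝔸] (D : Lemma4Data P i 𝓜 c) (hR : B12Sec2to5.Lemma4Restrictions c)
    (E : (PBond P i → 𝔸) × (PBond P i → 𝔸) → V)
    (hE : ∀ Ψ ∈ space' 𝓜 D.F D.cs c.α₀ c.α₁, AnalyticAt ℂ E ((fun b => (Ψ.U b : 𝔸)), Ψ.J))
    {Φ : FieldPair P i 𝔸ˣ 𝔸} {A B : PBond P i → 𝔸}
    (hΦ : Φ ∈ space 𝓜 D.F' D.cs' ((1 + 2 * c.β) * c.α₀) ((1 + 2 * c.β) * c.α₁) D.γ₀') (hA : A ∈ D.A331)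
    {r : ℝ} (hdom : ∀ σ ∈ ball (0 : ℂ) r, D.normB (σ • B) < c.α₃) (G : ℂ → PBond P i → 𝔸ˣ)
    (hcoh : ∀ τ ∈ Icc (0 : ℝ) 1, ∀ σ ∈ ball (0 : ℂ) r,
      (fun b => expI D.cs.ξ (D.K Φ A τ b + D.A₂ Φ A τ (σ • B) b)) = G ((τ : ℂ) + σ))
    {τ : ℝ} (hτ : τ ∈ Icc (0 : ℝ) 1) :
    DifferentiableOn ℂ (fun z : ℂ => E ((fun b => ((ofBackground D.π D.cs.ξ (G z)).U b : 𝔸)),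
      (ofBackground D.π D.cs.ξ (G z)).J)) (ball (τ : ℂ) r) := by
  have hdom' : ∀ σ ∈ ball (0 : ℂ) r, D.normB ((0 : PBond P i → 𝔸) + σ • B) < c.α₃ := fun σ hσ => by
    rw [zero_add]; exact hdom σ hσ
  have hslice := differentiableOn_E_slice D hR E hE hΦ hA hτ.1 hτ.2 hdom'
  simp only [zero_add] at hslice
  -- the function of (3.54) on `ball τ r` is the slice composed with `z ↦ z − τ`
  have hmaps : MapsTo (fun z : ℂ => z - (τ : ℂ)) (ball (τ : ℂ) r) (ball (0 : ℂ) r) := fun z hz => by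
    simpa only [mem_ball, dist_eq_norm, sub_zero] using hz
  have hcomp := hslice.comp ((differentiableOn_id (𝕜 := ℂ)).sub_const (τ : ℂ)) hmaps
  refine hcomp.congr fun z hz => ?_
  have hσ : z - (τ : ℂ) ∈ ball (0 : ℂ) r := hmaps hz
  have hG : G z = fun b => expI D.cs.ξ (D.K Φ A τ b + D.A₂ Φ A τ ((z - (τ : ℂ)) • B) b) := by
    rw [hcoh τ hτ (z - τ) hσ, add_sub_cancel]
  simp only [Function.comp_def, id_eq, hG]

omit [NormedSpace ℂ V] in
/-- On the same disc the function of (3.54) is bounded by the (1.18) sup (Lemma 4: its configurations lie in `U^c_j(X, α₀, α₁)`).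
[cite: Balaban1987RG1, (3.54) p.280; (1.18) p.263] -/
theorem norm_E354_le [NormOneClass 𝔸] (D : Lemma4Data P i 𝓜 c) (hR : B12Sec2to5.Lemma4Restrictions c)
    (E : (PBond P i → 𝔸) × (PBond P i → 𝔸) → V) {M : ℝ}
    (hM : ∀ Ψ ∈ space' 𝓜 D.F D.cs c.α₀ c.α₁, ‖E ((fun b => (Ψ.U b : 𝔸)), Ψ.J)‖ ≤ M)
    {Φ : FieldPair P i 𝔸ˣ 𝔸} {A B : PBond P i → 𝔸}
    (hΦ : Φ ∈ space 𝓜 D.F' D.cs' ((1 + 2 * c.β) * c.α₀) ((1 + 2 * c.β) * c.α₁) D.γ₀') (hA : A ∈ D.A331)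
    {r : ℝ} (hdom : ∀ σ ∈ ball (0 : ℂ) r, D.normB (σ • B) < c.α₃) (G : ℂ → PBond P i → 𝔸ˣ)
    (hcoh : ∀ τ ∈ Icc (0 : ℝ) 1, ∀ σ ∈ ball (0 : ℂ) r,
      (fun b => expI D.cs.ξ (D.K Φ A τ b + D.A₂ Φ A τ (σ • B) b)) = G ((τ : ℂ) + σ))
    {τ : ℝ} (hτ : τ ∈ Icc (0 : ℝ) 1) :
    ∀ z ∈ ball (τ : ℂ) r, ‖E ((fun b => ((ofBackground D.π D.cs.ξ (G z)).U b : 𝔸)),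
      (ofBackground D.π D.cs.ξ (G z)).J)‖ ≤ M := by
  intro z hz
  have hσ : z - (τ : ℂ) ∈ ball (0 : ℂ) r := by simpa only [mem_ball, dist_eq_norm, sub_zero] using hz
  have hG : G z = fun b => expI D.cs.ξ (D.K Φ A τ b + D.A₂ Φ A τ ((z - (τ : ℂ)) • B) b) := by
    rw [hcoh τ hτ (z - τ) hσ, add_sub_cancel]
  rw [hG]
  exact hM _ (comp_mem_Ucj D hR hΦ hA hτ.1 hτ.2 (hdom _ hσ))

/-- **(3.54) END TO END ON THE CONCRETE FRAME** — `B12CauchyRemainder354.ineq354` (unit r20: the last term of (3.34),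
`∫₀¹ dτ ((1−τ)⁴/4!) Φ⁽⁵⁾(τ)` for `Φ(z) = 𝐄^{(j)}(X, U_j(□₀, exp izB))`, has norm `≤ M/r⁵` if `Φ` is holomorphic and bounded by `M` on every
disc `|z − τ| < r`, `τ ∈ [0, 1]`) WITH ITS TWO HYPOTHESES DISCHARGED by Lemma 4 on the frame (§2) and the p. 263 hypotheses on
`𝐄^{(j)}(X, ·)`: for `𝐔 ∈ U′ᶜ_{k+1}(□₀, (1+2β)α₀, (1+2β)α₁)`, `𝐀` in (3.31), a field `B` with `|σB| < α₃` for `|σ| < r`, and the configuration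
`G z = U_j(□₀, exp izB)` cohering with the frame (`hcoh`). [cite: Balaban1987RG1, (3.54) p.280] -/
theorem ineq354_frameOf [NormOneClass 𝔸] [CompleteSpace V] (D : Lemma4Data P i 𝓜 c)
    (hR : B12Sec2to5.Lemma4Restrictions c) (E : (PBond P i → 𝔸) × (PBond P i → 𝔸) → V) {M : ℝ}
    (hE : ∀ Ψ ∈ space' 𝓜 D.F D.cs c.α₀ c.α₁, AnalyticAt ℂ E ((fun b => (Ψ.U b : 𝔸)), Ψ.J))
    (hM : ∀ Ψ ∈ space' 𝓜 D.F D.cs c.α₀ c.α₁, ‖E ((fun b => (Ψ.U b : 𝔸)), Ψ.J)‖ ≤ M)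
    {Φ : FieldPair P i 𝔸ˣ 𝔸} {A B : PBond P i → 𝔸}
    (hΦ : Φ ∈ space 𝓜 D.F' D.cs' ((1 + 2 * c.β) * c.α₀) ((1 + 2 * c.β) * c.α₁) D.γ₀') (hA : A ∈ D.A331)
    {r : ℝ} (hr : 0 < r) (hdom : ∀ σ ∈ ball (0 : ℂ) r, D.normB (σ • B) < c.α₃) (G : ℂ → PBond P i → 𝔸ˣ)
    (hcoh : ∀ τ ∈ Icc (0 : ℝ) 1, ∀ σ ∈ ball (0 : ℂ) r,
      (fun b => expI D.cs.ξ (D.K Φ A τ b + D.A₂ Φ A τ (σ • B) b)) = G ((τ : ℂ) + σ)) :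
    ‖∫ τ in (0 : ℝ)..1, ((1 - τ) ^ 4 / (4 ! : ℝ)) • iteratedDeriv 5 (fun z : ℂ => E
        ((fun b => ((ofBackground D.π D.cs.ξ (G z)).U b : 𝔸)), (ofBackground D.π D.cs.ξ (G z)).J)) (τ : ℂ)‖
      ≤ M / r ^ 5 :=
  ineq354 hr (fun _ hτ => differentiableOn_E354_ball D hR E hE hΦ hA hdom G hcoh hτ)
    (fun _ hτ => norm_E354_le D hR E hM hΦ hA hdom G hcoh hτ)

/-- **(3.54) with the printed constants on the concrete frame**: `r = α₃/|B|` from `|σB| ≤ |σ|·|B|`, `|B| = nB > 0`, and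
`M = E₀exp(−κd_j(X))` give `≦ E₀α₃⁻⁵|B|⁵exp(−κd_j(X))` (`B12CauchyRemainder354.ineq354_printed`, hypotheses discharged as in
`ineq354_frameOf`). [cite: Balaban1987RG1, (3.54) p.280] -/
theorem ineq354_frameOf_printed [NormOneClass 𝔸] [CompleteSpace V] (D : Lemma4Data P i 𝓜 c)
    (hR : B12Sec2to5.Lemma4Restrictions c) (E : (PBond P i → 𝔸) × (PBond P i → 𝔸) → V) {E₀ κ d : ℝ}
    (hE : ∀ Ψ ∈ space' 𝓜 D.F D.cs c.α₀ c.α₁, AnalyticAt ℂ E ((fun b => (Ψ.U b : 𝔸)), Ψ.J))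
    (hM : ∀ Ψ ∈ space' 𝓜 D.F D.cs c.α₀ c.α₁, ‖E ((fun b => (Ψ.U b : 𝔸)), Ψ.J)‖ ≤ E₀ * Real.exp (-(κ * d)))
    {Φ : FieldPair P i 𝔸ˣ 𝔸} {A B : PBond P i → 𝔸}
    (hΦ : Φ ∈ space 𝓜 D.F' D.cs' ((1 + 2 * c.β) * c.α₀) ((1 + 2 * c.β) * c.α₁) D.γ₀') (hA : A ∈ D.A331)
    {nB : ℝ} (hnB : 0 < nB) (hhom : ∀ σ : ℂ, D.normB (σ • B) ≤ ‖σ‖ * nB) (G : ℂ → PBond P i → 𝔸ˣ)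
    (hcoh : ∀ τ ∈ Icc (0 : ℝ) 1, ∀ σ ∈ ball (0 : ℂ) (c.α₃ / nB),
      (fun b => expI D.cs.ξ (D.K Φ A τ b + D.A₂ Φ A τ (σ • B) b)) = G ((τ : ℂ) + σ)) :
    ‖∫ τ in (0 : ℝ)..1, ((1 - τ) ^ 4 / (4 ! : ℝ)) • iteratedDeriv 5 (fun z : ℂ => E
        ((fun b => ((ofBackground D.π D.cs.ξ (G z)).U b : 𝔸)), (ofBackground D.π D.cs.ξ (G z)).J)) (τ : ℂ)‖
      ≤ E₀ * c.α₃⁻¹ ^ 5 * nB ^ 5 * Real.exp (-(κ * d)) := by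
  have hα₃ : 0 < c.α₃ := hR.2.2.2.1
  have hdom : ∀ σ ∈ ball (0 : ℂ) (c.α₃ / nB), D.normB (σ • B) < c.α₃ := by
    intro σ hσ
    rw [mem_ball_zero_iff] at hσ
    calc D.normB (σ • B) ≤ ‖σ‖ * nB := hhom σ
      _ < c.α₃ / nB * nB := by gcongr
      _ = c.α₃ := div_mul_cancel₀ _ hnB.ne'
  exact ineq354_printed hα₃ hnB (fun _ hτ => differentiableOn_E354_ball D hR E hE hΦ hA hdom G hcoh hτ)
    (fun _ hτ => norm_E354_le D hR E hM hΦ hA hdom G hcoh hτ)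

/-! ## §5. p. 275: «We will prove that it [(3.25)] is analytic on the space U^c_{k+1}(□₀, (1+2β)α₀, (1+2β)α₁, α₀)» — modulo (3.28) and (1.19) -/

omit [NormedAddCommGroup V] [NormedSpace ℂ V] in
/-- (1.19) applied to a `Gᶜ`-gauge transform of a Lemma-4 configuration: `𝐄^{(j)}(X, (V, J(V))^u) = 𝐄^{(j)}(X, (V, J(V)))`.
[cite: Balaban1987RG1, (1.19) p.263; (3.28)-(3.29) p.276] -/
theorem E_act_comp_eq [NormOneClass 𝔸] (D : Lemma4Data P i 𝓜 c) (hR : B12Sec2to5.Lemma4Restrictions c)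
    (E : (PBond P i → 𝔸) × (PBond P i → 𝔸) → V)
    (hinv : ∀ Ψ ∈ space' 𝓜 D.F D.cs c.α₀ c.α₁, ∀ u : Site P i → 𝔸ˣ, (∀ x, u x ∈ 𝓜.Gc) →
      E ((fun b => ((act u Ψ).U b : 𝔸)), (act u Ψ).J) = E ((fun b => (Ψ.U b : 𝔸)), Ψ.J))
    {Φ : FieldPair P i 𝔸ˣ 𝔸} {A B' : PBond P i → 𝔸} {τ : ℝ}
    (hΦ : Φ ∈ space 𝓜 D.F' D.cs' ((1 + 2 * c.β) * c.α₀) ((1 + 2 * c.β) * c.α₁) D.γ₀') (hA : A ∈ D.A331)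
    (hτ0 : 0 ≤ τ) (hτ1 : τ ≤ 1) (hB' : D.normB B' < c.α₃) {u : Site P i → 𝔸ˣ} (hu : ∀ x, u x ∈ 𝓜.Gc) :
    E ((fun b => ((act u (ofBackground D.π D.cs.ξ
        (fun b => expI D.cs.ξ (D.K Φ A τ b + D.A₂ Φ A τ B' b)))).U b : 𝔸)),
      (act u (ofBackground D.π D.cs.ξ (fun b => expI D.cs.ξ (D.K Φ A τ b + D.A₂ Φ A τ B' b)))).J) =
    E ((fun b => ((ofBackground D.π D.cs.ξ
        (fun b => expI D.cs.ξ (D.K Φ A τ b + D.A₂ Φ A τ B' b))).U b : 𝔸)),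
      (ofBackground D.π D.cs.ξ (fun b => expI D.cs.ξ (D.K Φ A τ b + D.A₂ Φ A τ B' b))).J) :=
  hinv _ (comp_mem_Ucj D hR hΦ hA hτ0 hτ1 hB') u hu

/-- **p. 275, the analyticity claim for (3.25), assembled modulo (3.28) and (1.19)** («This is obviously a well defined and analytic function
of the variables 𝐔, 𝐉 in a sufficiently small domain. We will prove that it is analytic on the space U^c_{k+1}(□₀, (1+2β)α₀, (1+2β)α₁, α₀)»;
p. 276 «Performing these gauge transformations in (3.25) we obtain (3.28) … Making use of the gauge invariance of the function (3.25) …»):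
if along an analytic family of the variables, near the base point, the (3.25) configuration `cfg325(e)` IS a `Gᶜ`-valued gauge transform
`g(e)` ((3.26)/(3.27): `v`, `u_{k+1}`) of the Lemma-4 configuration `(V, J(V))(𝐔(e), 𝐀(e), τ, B′(e))` (the identity behind (3.28) together with
(3.30)/(3.48), BY REFERENCE: `h328`), the variables stay in the printed domain near the base point (`hdomf`), and `𝐄^{(j)}(X, ·)` satisfies
(1.19) (`hinv`) and is analytic on `U^c_j(X, α₀, α₁)` (`hE`), then `e ↦ 𝐄^{(j)}(X, cfg325(e))` is analytic at the base point: by (1.19) it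
coincides near the base point with the function of §1. [cite: Balaban1987RG1, p.275 after (3.25); (3.28) p.276; (1.19) p.263] -/
theorem analyticAt_E325_of_eq328 [NormOneClass 𝔸] (D : Lemma4Data P i 𝓜 c) (hR : B12Sec2to5.Lemma4Restrictions c)
    (E : (PBond P i → 𝔸) × (PBond P i → 𝔸) → V)
    (hE : ∀ Ψ ∈ space' 𝓜 D.F D.cs c.α₀ c.α₁, AnalyticAt ℂ E ((fun b => (Ψ.U b : 𝔸)), Ψ.J))
    (hinv : ∀ Ψ ∈ space' 𝓜 D.F D.cs c.α₀ c.α₁, ∀ u : Site P i → 𝔸ˣ, (∀ x, u x ∈ 𝓜.Gc) →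
      E ((fun b => ((act u Ψ).U b : 𝔸)), (act u Ψ).J) = E ((fun b => (Ψ.U b : 𝔸)), Ψ.J))
    {W : Type} [NormedAddCommGroup W] [NormedSpace ℂ W] {Φf : W → FieldPair P i 𝔸ˣ 𝔸} {Af Bf : W → PBond P i → 𝔸}
    {cfg325 : W → FieldPair P i 𝔸ˣ 𝔸} {g : W → Site P i → 𝔸ˣ} {e₀ : W} {τ : ℝ} (hLe : LettersAnalyticAt Φf Af Bf e₀)
    (hτ0 : 0 ≤ τ) (hτ1 : τ ≤ 1)
    (hdomf : ∀ᶠ e in 𝓝 e₀, Φf e ∈ space 𝓜 D.F' D.cs' ((1 + 2 * c.β) * c.α₀) ((1 + 2 * c.β) * c.α₁) D.γ₀' ∧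
      Af e ∈ D.A331 ∧ D.normB (Bf e) < c.α₃)
    (hg : ∀ᶠ e in 𝓝 e₀, ∀ x, g e x ∈ 𝓜.Gc)
    (h328 : ∀ᶠ e in 𝓝 e₀, cfg325 e = act (g e) (ofBackground D.π D.cs.ξ
      (fun b => expI D.cs.ξ (D.K (Φf e) (Af e) τ b + D.A₂ (Φf e) (Af e) τ (Bf e) b)))) :
    AnalyticAt ℂ (fun e : W => E ((fun b => ((cfg325 e).U b : 𝔸)), (cfg325 e).J)) e₀ := by
  obtain ⟨hΦ, hA, hB'⟩ := hdomf.self_of_nhds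
  have han := analyticAt_E_comp D hR E hE hLe hΦ hA hτ0 hτ1 hB'
  refine han.congr ?_
  filter_upwards [hdomf, hg, h328] with e he hge h328e
  obtain ⟨hΦe, hAe, hBe⟩ := he
  rw [h328e]
  exact (E_act_comp_eq D hR E hinv hΦe hAe hτ0 hτ1 hBe hge).symm


/-! ## §6 (v1.1). (4.2) p. 281 and the `𝐔`-level reading of (3.28): the `𝐉`-slot follows from the (1.9)/(1.10) intertwining

The by-reference identities of §5 and of (4.2) are printed at the level of the GAUGE FIELD (`U_j(□₀, exp iB) = (exp iξ𝐇_j(□₀, B))^{u′}`, the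
gauge transformation «in (3.37)»; (3.26)–(3.28)); the `𝐉`-slots of both sides are the currents (1.8) of their `𝐔`-slots (p. 275 «determined by
the analytic function 𝐄^{(j)}(X, 𝐔, 𝐉), as in (3.13)»), and `(𝐔^u, J(𝐔^u)) = (𝐔, J(𝐔))^u` is the tree's `B12Eq18Current.ofBackground_gaugeU` (for `π`
commuting with the adjoint action — the frame's `hπR`).  So the pair-level hypotheses of §5 reduce to `𝐔`-level ones. -/

omit [NormedAddCommGroup V] [NormedSpace ℂ V] in
/-- (1.19) after the (1.9)/(1.10) intertwining: for a `Gᶜ`-valued gauge transformation `u` and the Lemma-4 configuration `V = exp iξ(𝐊 + 𝐀₂)` in the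
printed domain, `𝐄^{(j)}(X, (V^u, J(V^u))) = 𝐄^{(j)}(X, (V, J(V)))` (`ofBackground_gaugeU` + `E_act_comp_eq`).
[cite: Balaban1987RG1, (1.19) p.263 with (1.9)-(1.10) pp.261-262] -/
theorem E_ofBackground_gaugeU_comp_eq [NormOneClass 𝔸] (D : Lemma4Data P i 𝓜 c) (hR : B12Sec2to5.Lemma4Restrictions c)
    (E : (PBond P i → 𝔸) × (PBond P i → 𝔸) → V)
    (hinv : ∀ Ψ ∈ space' 𝓜 D.F D.cs c.α₀ c.α₁, ∀ u : Site P i → 𝔸ˣ, (∀ x, u x ∈ 𝓜.Gc) →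
      E ((fun b => ((act u Ψ).U b : 𝔸)), (act u Ψ).J) = E ((fun b => (Ψ.U b : 𝔸)), Ψ.J))
    {Φ : FieldPair P i 𝔸ˣ 𝔸} {A B' : PBond P i → 𝔸} {τ : ℝ}
    (hΦ : Φ ∈ space 𝓜 D.F' D.cs' ((1 + 2 * c.β) * c.α₀) ((1 + 2 * c.β) * c.α₁) D.γ₀') (hA : A ∈ D.A331)
    (hτ0 : 0 ≤ τ) (hτ1 : τ ≤ 1) (hB' : D.normB B' < c.α₃) {u : Site P i → 𝔸ˣ} (hu : ∀ x, u x ∈ 𝓜.Gc) :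
    E ((fun b => ((ofBackground D.π D.cs.ξ (gaugeU u
        (fun b => expI D.cs.ξ (D.K Φ A τ b + D.A₂ Φ A τ B' b)))).U b : 𝔸)),
      (ofBackground D.π D.cs.ξ (gaugeU u (fun b => expI D.cs.ξ (D.K Φ A τ b + D.A₂ Φ A τ B' b)))).J) =
    E ((fun b => ((ofBackground D.π D.cs.ξ
        (fun b => expI D.cs.ξ (D.K Φ A τ b + D.A₂ Φ A τ B' b))).U b : 𝔸)),
      (ofBackground D.π D.cs.ξ (fun b => expI D.cs.ξ (D.K Φ A τ b + D.A₂ Φ A τ B' b))).J) := by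
  rw [ofBackground_gaugeU D.π D.cs.ξ u (fun x X => D.hπR (u x) X)]
  exact E_act_comp_eq D hR E hinv hΦ hA hτ0 hτ1 hB' hu

omit [NormedAddCommGroup V] [NormedSpace ℂ V] in
/-- **(4.2)** (p. 281 [33], verbatim: *«Using the gauge transformation in (3.37), and the gauge invariance of the function 𝐄^{(j)}(X, U), we have
𝐄^{(j)}(X, U_j(□₀, exp iB)) = 𝐄^{(j)}(X, exp iξ𝐇_j(□₀, B)). (4.2)»*) **on the concrete frame**: in the Lemma-4 parametrisation `B = τB(𝐀) + B′`,
`exp iξ𝐇_j(□₀, B)` is the frame's `V = exp iξ(𝐊(𝐔, 𝐀, τ) + 𝐀₂(𝐔, 𝐀, τ, B′))` ((3.50)); if the configuration `U_j(□₀, exp iB)` IS `V^{u′}` for a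
`Gᶜ`-valued `u′` («the gauge transformation in (3.37)», [15] — BY REFERENCE, hypothesis `h337`), then, for `𝐄^{(j)}(X, ·)` satisfying (1.19),
`𝐄^{(j)}` at the pair `(U_j, J(U_j))` ((1.9)) equals `𝐄^{(j)}` at `(V, J(V))`. [cite: Balaban1987RG1, (4.2) p.281; (3.37) p.277; (1.19) p.263] -/
theorem eq42_of_eq337 [NormOneClass 𝔸] (D : Lemma4Data P i 𝓜 c) (hR : B12Sec2to5.Lemma4Restrictions c)
    (E : (PBond P i → 𝔸) × (PBond P i → 𝔸) → V)
    (hinv : ∀ Ψ ∈ space' 𝓜 D.F D.cs c.α₀ c.α₁, ∀ u : Site P i → 𝔸ˣ, (∀ x, u x ∈ 𝓜.Gc) →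
      E ((fun b => ((act u Ψ).U b : 𝔸)), (act u Ψ).J) = E ((fun b => (Ψ.U b : 𝔸)), Ψ.J))
    {Φ : FieldPair P i 𝔸ˣ 𝔸} {A B' : PBond P i → 𝔸} {τ : ℝ}
    (hΦ : Φ ∈ space 𝓜 D.F' D.cs' ((1 + 2 * c.β) * c.α₀) ((1 + 2 * c.β) * c.α₁) D.γ₀') (hA : A ∈ D.A331)
    (hτ0 : 0 ≤ τ) (hτ1 : τ ≤ 1) (hB' : D.normB B' < c.α₃) {Uj : PBond P i → 𝔸ˣ} {u' : Site P i → 𝔸ˣ}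
    (hu' : ∀ x, u' x ∈ 𝓜.Gc) (h337 : Uj = gaugeU u' (fun b => expI D.cs.ξ (D.K Φ A τ b + D.A₂ Φ A τ B' b))) :
    E ((fun b => ((ofBackground D.π D.cs.ξ Uj).U b : 𝔸)), (ofBackground D.π D.cs.ξ Uj).J) =
    E ((fun b => ((ofBackground D.π D.cs.ξ
        (fun b => expI D.cs.ξ (D.K Φ A τ b + D.A₂ Φ A τ B' b))).U b : 𝔸)),
      (ofBackground D.π D.cs.ξ (fun b => expI D.cs.ξ (D.K Φ A τ b + D.A₂ Φ A τ B' b))).J) := by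
  rw [h337]
  exact E_ofBackground_gaugeU_comp_eq D hR E hinv hΦ hA hτ0 hτ1 hB' hu'

/-- **p. 275, the analyticity claim for (3.25), with the `𝐔`-level identity behind (3.28)**: as `analyticAt_E325_of_eq328`, but the by-reference
input is only the gauge-field identity «the (3.25) configuration `U325(e)` is the gauge transform `V(e)^{g(e)}` of the Lemma-4 configuration»
((3.26)–(3.28) with (3.30)/(3.48); `h328`), the `𝐉`-slot of (3.25) being the current of its `𝐔`-slot ((1.9), p. 275) and following by
`ofBackground_gaugeU`. [cite: Balaban1987RG1, p.275 after (3.25); (3.28) p.276; (1.9)-(1.10) pp.261-262; (1.19) p.263] -/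
theorem analyticAt_E325_of_eq328U [NormOneClass 𝔸] (D : Lemma4Data P i 𝓜 c) (hR : B12Sec2to5.Lemma4Restrictions c)
    (E : (PBond P i → 𝔸) × (PBond P i → 𝔸) → V)
    (hE : ∀ Ψ ∈ space' 𝓜 D.F D.cs c.α₀ c.α₁, AnalyticAt ℂ E ((fun b => (Ψ.U b : 𝔸)), Ψ.J))
    (hinv : ∀ Ψ ∈ space' 𝓜 D.F D.cs c.α₀ c.α₁, ∀ u : Site P i → 𝔸ˣ, (∀ x, u x ∈ 𝓜.Gc) →
      E ((fun b => ((act u Ψ).U b : 𝔸)), (act u Ψ).J) = E ((fun b => (Ψ.U b : 𝔸)), Ψ.J))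
    {W : Type} [NormedAddCommGroup W] [NormedSpace ℂ W] {Φf : W → FieldPair P i 𝔸ˣ 𝔸} {Af Bf : W → PBond P i → 𝔸}
    {U325 : W → PBond P i → 𝔸ˣ} {g : W → Site P i → 𝔸ˣ} {e₀ : W} {τ : ℝ} (hLe : LettersAnalyticAt Φf Af Bf e₀)
    (hτ0 : 0 ≤ τ) (hτ1 : τ ≤ 1)
    (hdomf : ∀ᶠ e in 𝓝 e₀, Φf e ∈ space 𝓜 D.F' D.cs' ((1 + 2 * c.β) * c.α₀) ((1 + 2 * c.β) * c.α₁) D.γ₀' ∧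
      Af e ∈ D.A331 ∧ D.normB (Bf e) < c.α₃)
    (hg : ∀ᶠ e in 𝓝 e₀, ∀ x, g e x ∈ 𝓜.Gc)
    (h328 : ∀ᶠ e in 𝓝 e₀, U325 e = gaugeU (g e)
      (fun b => expI D.cs.ξ (D.K (Φf e) (Af e) τ b + D.A₂ (Φf e) (Af e) τ (Bf e) b))) :
    AnalyticAt ℂ (fun e : W => E ((fun b => ((ofBackground D.π D.cs.ξ (U325 e)).U b : 𝔸)),
      (ofBackground D.π D.cs.ξ (U325 e)).J)) e₀ := by
  refine analyticAt_E325_of_eq328 D hR E hE hinv (cfg325 := fun e => ofBackground D.π D.cs.ξ (U325 e)) hLe hτ0 hτ1 hdomf hg ?_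
  filter_upwards [h328] with e he
  simp only [he, ofBackground_gaugeU D.π D.cs.ξ (g e) (fun x X => D.hπR (g e x) X)]

/-! ## §7 (v1.1). «for α₀, α₁, α₂, α₃ sufficiently small»: `B12Sec2to5.Lemma4PrintedSmall` on the concrete frames -/

/-- **The threshold form `B12Sec2to5.Lemma4PrintedSmall` of Lemma 4, on the concrete frames**: for a family of by-reference packages
`D α₀ α₁ α₂ α₃` (the [15]-inputs for every value of the four constants, the others `B₃, O(1), M, L, β₀, β` fixed), the family of concrete frames
satisfies `Lemma4PrintedSmall` — with ANY threshold, since `Lemma4Printed` is conditional on «all the restrictions» and `lemma4Printed_frameOf`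
holds for every package.  HONEST SCOPE: at the frame level the printed «sufficiently small» is carried entirely by the AVAILABILITY of the packages
(the smallness hypotheses of the Propositions of [15] that produce `𝐇_j(□₀, ·)`, the gauge transformations and their bounds), i.e. by the
hypothesis that the family `D` exists; this theorem records only that nothing further is needed. [cite: Balaban1987RG1, Lemma 4 p.280] -/
theorem lemma4PrintedSmall_frameOf [NormOneClass 𝔸] {B₃ O₁ M L β₀ β : ℝ}
    (D : ∀ α₀ α₁ α₂ α₃ : ℝ, Lemma4Data P i 𝓜 ⟨B₃, O₁, M, L, β₀, β, α₀, α₁, α₂, α₃⟩) :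
    B12Sec2to5.Lemma4PrintedSmall (fun α₀ α₁ α₂ α₃ => frameOf 𝓜 ⟨B₃, O₁, M, L, β₀, β, α₀, α₁, α₂, α₃⟩ (D α₀ α₁ α₂ α₃))
      B₃ O₁ M L β₀ β :=
  ⟨1, one_pos, fun α₀ α₁ α₂ α₃ _ _ _ _ => lemma4Printed_frameOf (D α₀ α₁ α₂ α₃)⟩

end Literature.MathematicalPhysics.QuantumFieldTheory.Balaban1983to89.B12Lemma4Uses
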